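import Summits.NavierStokesRegularity.NavierStokesRegularity.Theorems.TypeICertificateLadderTargetStrainCubeInterpolation
import Summits.NavierStokesRegularity.NavierStokesRegularity.Theorems.TypeICertificateLadderTargetStrainCubeOpNorm
import HarnessLib

/-!
# Crux `Target` = `TypeICertificateLadder.NoTypeIBlowup` (stmt-NavierStokesRegularity-1217), line
# `depletion-ladder`: THE SHARP STRAIN-CUBE INTERPOLATION (operator-norm gain `√(2/3)`)

`--supports stmt-NavierStokesRegularity-1217` (sharpening of the landed `…StrainCubeInterpolation.lean`:
the `S∇N` term of the entrywise integration by parts is bounded with the operator norm of the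
trace-free strain, `|S|_op ≤ √(2/3)|S|_F` (`…StrainCubeOpNorm.lean`), instead of its Frobenius norm):

  `∫ q √q ≤ M · ( ½ √(∫‖Δv‖²) √(∫q) + √(2/3) √(∫q) √(∫ Σₗᵢⱼ (∂ₗsᵢⱼ)²) )`   (`integral_strainCube_le_sharp`),

which upgrades the depletion constant from `(√3+√6)/9 ≈ 0.4646` to `(2+√3)/9 ≈ 0.4147` and the rungs
from `C < 2.152` to `C < 18 − 9√3 ≈ 2.41` (sequel file). Proofs are those of the landed file with the
one factor threaded through. WHAT THIS IS NOT: kinematics of one slice. [folklore]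
-/

noncomputable section

open Set Function Filter Topology MeasureTheory Finset
open scoped RealInnerProductSpace ENNReal NNReal Laplacian ContDiff
open Literature.Analysis.FluidPDE

namespace Summit.NavierStokesRegularity.NavierStokesRegularity.Theorems.DepletionLadder.StrainCube

-- the problem directory repeats the summit name (`NavierStokesRegularity/NavierStokesRegularity`)
set_option linter.dupNamespace false

open Summit.NavierStokesRegularity.NavierStokesRegularity.Theorems.RungReynoldsOne.WeightedSlice

variable {v : EuclideanSpace ℝ (Fin 3) → EuclideanSpace ℝ (Fin 3)}
  {s : Fin 3 → Fin 3 → EuclideanSpace ℝ (Fin 3) → ℝ} {N : EuclideanSpace ℝ (Fin 3) → ℝ}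

/-! ## The sharp pointwise step -/

/-- The strain is symmetric and trace free (`Σᵢ sᵢᵢ = div v = 0`). [folklore] -/
theorem sym_symm_trace (hv : ContDiff ℝ ∞ v) (hdiv : VectorCalculus.IsDivFree v)
    (hs : ∀ i j y, s i j y = (pderiv j (fun z => v z i) y + pderiv i (fun z => v z j) y) / 2)
    (x : EuclideanSpace ℝ (Fin 3)) :
    (∀ i j, s i j x = s j i x) ∧ s 0 0 x + s 1 1 x + s 2 2 x = 0 := by
  refine ⟨fun i j => by rw [hs, hs]; ring, ?_⟩
  have h := hdiv.sum_pderiv_comp_eq_zero (hv.differentiable (by simp)) x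
  simp only [Fin.sum_univ_three] at h
  rw [hs, hs, hs]
  linarith

/-- **The sharp pointwise bound**: with `|v| ≤ M`, `0 ≤ N`, `Σⱼ (∂ⱼN)² ≤ D`:
`−Σᵢⱼ ∂ⱼ(sᵢⱼN) vᵢ ≤ M (½ N ‖Δv‖ + √(2/3) √q √D)`. [folklore] -/
theorem neg_sum_pderiv_mul_weight_le_sharp (hv : ContDiff ℝ ∞ v) (hdiv : VectorCalculus.IsDivFree v)
    (hs : ∀ i j y, s i j y = (pderiv j (fun z => v z i) y + pderiv i (fun z => v z j) y) / 2)
    {N : EuclideanSpace ℝ (Fin 3) → ℝ} (hN : Differentiable ℝ N) {M D : ℝ} (x : EuclideanSpace ℝ (Fin 3))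
    (hM : ‖v x‖ ≤ M) (hN0 : 0 ≤ N x) (hD : ∑ j, pderiv j N x ^ 2 ≤ D) :
    -(∑ i, ∑ j, pderiv j (fun y => s i j y * N y) x * v x i) ≤
      M * ((1 / 2) * (N x * ‖(Δ v) x‖) +
        Real.sqrt (2 / 3) * (Real.sqrt (∑ i, ∑ j, s i j x ^ 2) * Real.sqrt D)) := by
  rw [sum_pderiv_mul_weight_eq hv hdiv hs hN x]
  obtain ⟨hsym, htr⟩ := sym_symm_trace hv hdiv hs x
  have hM0 : 0 ≤ M := (norm_nonneg _).trans hM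
  have t1 := abs_sum_mul_half_laplacian_le (v := v) x
  have t2 := abs_bilin_sym_le (fun i j => s i j x) hsym htr (fun i => v x i) (fun j => pderiv j N x)
  have ev : Real.sqrt (∑ i, v x i ^ 2) = ‖v x‖ := by
    rw [← norm_sq_eq_sum_sq, Real.sqrt_sq (norm_nonneg _)]
  rw [ev] at t2
  have hD0 : 0 ≤ D := (sum_nonneg fun _ _ => sq_nonneg _).trans hD
  have hsD : Real.sqrt (∑ j, pderiv j N x ^ 2) ≤ Real.sqrt D := Real.sqrt_le_sqrt hD
  have hq0 : 0 ≤ Real.sqrt (∑ i, ∑ j, s i j x ^ 2) := Real.sqrt_nonneg _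
  have h23 : 0 ≤ Real.sqrt (2 / 3) := Real.sqrt_nonneg _
  -- first term
  have a1 : -(N x * ∑ i, v x i * ((1 / 2) * (Δ v) x i)) ≤ M * ((1 / 2) * (N x * ‖(Δ v) x‖)) := by
    have h := neg_abs_le (∑ i, v x i * ((1 / 2) * (Δ v) x i))
    have h2 : N x * |∑ i, v x i * ((1 / 2) * (Δ v) x i)| ≤ N x * ((1 / 2) * (M * ‖(Δ v) x‖)) :=
      mul_le_mul_of_nonneg_left (t1.trans (by nlinarith [norm_nonneg ((Δ v) x)])) hN0
    nlinarith
  -- second term, with the operator-norm gain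
  have a2 : -(∑ i, v x i * ∑ j, s i j x * pderiv j N x) ≤
      M * (Real.sqrt (2 / 3) * (Real.sqrt (∑ i, ∑ j, s i j x ^ 2) * Real.sqrt D)) := by
    have h := neg_abs_le (∑ i, v x i * ∑ j, s i j x * pderiv j N x)
    have h2 : Real.sqrt (2 / 3) * Real.sqrt (∑ i, ∑ j, s i j x ^ 2) * ‖v x‖ *
        Real.sqrt (∑ j, pderiv j N x ^ 2) ≤
        Real.sqrt (2 / 3) * Real.sqrt (∑ i, ∑ j, s i j x ^ 2) * M * Real.sqrt D :=
      mul_le_mul (mul_le_mul_of_nonneg_left hM (by positivity)) hsD (Real.sqrt_nonneg _) (by positivity)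
    linarith [t2]
  rw [neg_add, mul_add]
  exact add_le_add a1 a2

/-! ## The bound on `∫ q N` -/

/-- **`∫ q N ≤ M (½ √(∫‖Δv‖²) √(∫q) + √(2/3) √(∫q) √(∫D))`** (sharp form) for a smooth weight `N` with
`0 ≤ N ≤ √q`, `N ≤ 3‖D¹v‖`, `|∂ₗN| ≤ 6‖D²v‖`, `Σₗ (∂ₗN)² ≤ D`. [folklore] -/
theorem integral_sumSq_mul_weight_le_sharp (hv : ContDiff ℝ ∞ v) (hdiv : VectorCalculus.IsDivFree v)
    {M B : ℝ} (hM : ∀ x, ‖v x‖ ≤ M) (hB : ∀ x, ‖fderiv ℝ v x‖ ≤ B)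
    (h1 : ∫⁻ x, ‖iteratedFDeriv ℝ 1 v x‖ₑ ^ 2 < ⊤) (h2 : ∫⁻ x, ‖iteratedFDeriv ℝ 2 v x‖ₑ ^ 2 < ⊤)
    (hs : ∀ i j y, s i j y = (pderiv j (fun z => v z i) y + pderiv i (fun z => v z j) y) / 2)
    (hNC : ContDiff ℝ ∞ N) (hN0 : ∀ x, 0 ≤ N x)
    (hNq : ∀ x, N x ≤ Real.sqrt (∑ i, ∑ j, s i j x ^ 2))
    (hNle : ∀ x, N x ≤ 3 * ‖iteratedFDeriv ℝ 1 v x‖)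
    (hdN : ∀ l x, |pderiv l N x| ≤ 6 * ‖iteratedFDeriv ℝ 2 v x‖)
    (hdND : ∀ x, ∑ l, pderiv l N x ^ 2 ≤ ∑ l, ∑ i, ∑ j, pderiv l (s i j) x ^ 2) :
    ∫ x, (∑ i, ∑ j, s i j x ^ 2) * N x ≤
      M * ((1 / 2) * Real.sqrt (∫ x, ‖(Δ v) x‖ ^ 2) * Real.sqrt (∫ x, ∑ i, ∑ j, s i j x ^ 2) +
        Real.sqrt (2 / 3) * Real.sqrt (∫ x, ∑ i, ∑ j, s i j x ^ 2) *
          Real.sqrt (∫ x, ∑ l, ∑ i, ∑ j, pderiv l (s i j) x ^ 2)) := by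
  have hM0 : 0 ≤ M := (norm_nonneg _).trans (hM 0)
  have hsC := contDiff_sym hv hs
  have hNd : Differentiable ℝ N := hNC.differentiable (by simp)
  have cN : Continuous N := hNC.continuous
  -- everything involving the Laplacian, then generalize it away
  have cL : Continuous (Δ v) := continuous_laplacian_of hv
  have L_le : ∀ x, ‖(Δ v) x‖ ≤ 6 * ‖iteratedFDeriv ℝ 2 v x‖ := norm_laplacian_le hv
  have hpt : ∀ x, -(∑ i, ∑ j, pderiv j (fun y => s i j y * N y) x * v x i) ≤
      M * ((1 / 2) * (N x * ‖(Δ v) x‖) + Real.sqrt (2 / 3) *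
        (Real.sqrt (∑ i, ∑ j, s i j x ^ 2) * Real.sqrt (∑ l, ∑ i, ∑ j, pderiv l (s i j) x ^ 2))) :=
    fun x => neg_sum_pderiv_mul_weight_le_sharp hv hdiv hs hNd x (hM x) (hN0 x) (hdND x)
  rw [integral_sumSq_mul_weight_eq hv hM hB h1 h2 hs hNC hN0 hNle hdN, ← integral_neg]
  generalize Δ v = L at cL L_le hpt ⊢
  set q : EuclideanSpace ℝ (Fin 3) → ℝ := fun x => ∑ i, ∑ j, s i j x ^ 2 with hq
  set D : EuclideanSpace ℝ (Fin 3) → ℝ := fun x => ∑ l, ∑ i, ∑ j, pderiv l (s i j) x ^ 2 with hD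
  have cq : Continuous q := continuous_finsetSum _ fun i _ => continuous_finsetSum _ fun j _ =>
    ((hsC i j).continuous).pow 2
  have cD : Continuous D := continuous_finsetSum _ fun l _ => continuous_finsetSum _ fun i _ =>
    continuous_finsetSum _ fun j _ => ((contDiff_pderiv (hsC i j) l).continuous).pow 2
  have hq0 : ∀ x, 0 ≤ q x := fun x => sumSq_nonneg (s := s) x
  have hD0 : ∀ x, 0 ≤ D x := fun x =>
    sum_nonneg fun l _ => sumSq_nonneg (s := fun i j y => pderiv l (s i j) y) x
  -- integrability
  have P := integrable_ibp_products hv hM hB h1 h2 hs hNC hN0 hNle hdN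
  have iq : Integrable q := by
    refine integrable_of_le_iteratedFDeriv_mul hv h1 h1 cq 9 fun x => ?_
    rw [abs_of_nonneg (hq0 x)]
    nlinarith [sumSq_sym_le hv hs x]
  have iD : Integrable D := by
    refine integrable_of_le_iteratedFDeriv_mul hv h2 h2 cD 27 fun x => ?_
    rw [abs_of_nonneg (hD0 x)]
    nlinarith [gradSq_sym_le hv hs x]
  have iL2 : Integrable fun x => ‖L x‖ ^ 2 := by
    refine integrable_of_le_iteratedFDeriv_mul hv h2 h2 (cL.norm.pow 2) 36 fun x => ?_
    rw [abs_of_nonneg (sq_nonneg _)]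
    nlinarith [L_le x, norm_nonneg (L x)]
  have iNL : Integrable fun x => N x * ‖L x‖ := by
    refine integrable_of_le_iteratedFDeriv_mul hv h1 h2 (cN.mul cL.norm) 18 fun x => ?_
    rw [abs_mul, abs_of_nonneg (hN0 x), abs_of_nonneg (norm_nonneg _)]
    nlinarith [mul_le_mul (hNle x) (L_le x) (norm_nonneg _)
      (by positivity : (0:ℝ) ≤ 3 * ‖iteratedFDeriv ℝ 1 v x‖)]
  have iqD : Integrable fun x => Real.sqrt (q x) * Real.sqrt (D x) := by
    refine integrable_of_le_iteratedFDeriv_mul hv h1 h2 ((Real.continuous_sqrt.comp cq).mul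
      (Real.continuous_sqrt.comp cD)) 18 fun x => ?_
    rw [abs_mul, abs_of_nonneg (Real.sqrt_nonneg _), abs_of_nonneg (Real.sqrt_nonneg _)]
    nlinarith [mul_le_mul (sqrt_sumSq_sym_le hv hs x) (sqrt_gradSq_sym_le hv hs x) (Real.sqrt_nonneg _)
      (by positivity : (0:ℝ) ≤ 3 * ‖iteratedFDeriv ℝ 1 v x‖)]
  have iS : Integrable fun x => ∑ i, ∑ j, pderiv j (fun y => s i j y * N y) x * v x i :=
    integrable_finsetSum _ fun i _ => integrable_finsetSum _ fun j _ => (P i j).1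
  have iS' : Integrable fun x => -(∑ i, ∑ j, pderiv j (fun y => s i j y * N y) x * v x i) := iS.neg
  have iR : Integrable fun x => M * ((1 / 2) * (N x * ‖L x‖) +
      Real.sqrt (2 / 3) * (Real.sqrt (q x) * Real.sqrt (D x))) :=
    ((iNL.const_mul _).add (iqD.const_mul _)).const_mul M
  have step1 : ∫ x, -(∑ i, ∑ j, pderiv j (fun y => s i j y * N y) x * v x i) ≤
      M * ((1 / 2) * (∫ x, N x * ‖L x‖) + Real.sqrt (2 / 3) * ∫ x, Real.sqrt (q x) * Real.sqrt (D x)) := by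
    have h := integral_mono iS' iR hpt
    refine h.trans_eq ?_
    rw [integral_const_mul, integral_add (iNL.const_mul _) (iqD.const_mul _), integral_const_mul,
      integral_const_mul]
  -- Cauchy–Schwarz
  have N2_le : ∀ x, N x ^ 2 ≤ q x := fun x => by
    calc N x ^ 2 ≤ Real.sqrt (q x) ^ 2 := pow_le_pow_left₀ (hN0 x) (hNq x) 2
      _ = q x := Real.sq_sqrt (hq0 x)
  have iN2 : Integrable fun x => N x ^ 2 := by
    refine iq.mono' (cN.pow 2).aestronglyMeasurable (Eventually.of_forall fun x => ?_)
    rw [Real.norm_of_nonneg (sq_nonneg _)]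
    exact N2_le x
  have isq2 : Integrable fun x => Real.sqrt (q x) ^ 2 :=
    iq.congr (Eventually.of_forall fun x => (Real.sq_sqrt (hq0 x)).symm)
  have isD2 : Integrable fun x => Real.sqrt (D x) ^ 2 :=
    iD.congr (Eventually.of_forall fun x => (Real.sq_sqrt (hD0 x)).symm)
  have cs1 : ∫ x, N x * ‖L x‖ ≤ Real.sqrt (∫ x, q x) * Real.sqrt (∫ x, ‖L x‖ ^ 2) := by
    have h := integral_mul_le_sqrt_mul_sqrt (μ := volume) hN0 (fun x => norm_nonneg (L x))
      cN.aestronglyMeasurable cL.norm.aestronglyMeasurable iN2 iL2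
    refine h.trans (mul_le_mul_of_nonneg_right (Real.sqrt_le_sqrt ?_) (Real.sqrt_nonneg _))
    exact integral_mono iN2 iq N2_le
  have cs2 : ∫ x, Real.sqrt (q x) * Real.sqrt (D x) ≤ Real.sqrt (∫ x, q x) * Real.sqrt (∫ x, D x) := by
    have h := integral_mul_le_sqrt_mul_sqrt (μ := volume) (fun x => Real.sqrt_nonneg (q x))
      (fun x => Real.sqrt_nonneg (D x)) (Real.continuous_sqrt.comp cq).aestronglyMeasurable
      (Real.continuous_sqrt.comp cD).aestronglyMeasurable isq2 isD2
    have e1 : ∫ x, Real.sqrt (q x) ^ 2 = ∫ x, q x :=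
      integral_congr_ae (Eventually.of_forall fun x => Real.sq_sqrt (hq0 x))
    have e2 : ∫ x, Real.sqrt (D x) ^ 2 = ∫ x, D x :=
      integral_congr_ae (Eventually.of_forall fun x => Real.sq_sqrt (hD0 x))
    rw [e1, e2] at h
    exact h
  have hsq0 : 0 ≤ Real.sqrt (∫ x, q x) := Real.sqrt_nonneg _
  have hL0 : 0 ≤ Real.sqrt (∫ x, ‖L x‖ ^ 2) := Real.sqrt_nonneg _
  have h23 : 0 ≤ Real.sqrt (2 / 3) := Real.sqrt_nonneg _
  calc ∫ x, -(∑ i, ∑ j, pderiv j (fun y => s i j y * N y) x * v x i)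
      ≤ M * ((1 / 2) * (∫ x, N x * ‖L x‖) + Real.sqrt (2 / 3) * ∫ x, Real.sqrt (q x) * Real.sqrt (D x)) :=
        step1
    _ ≤ M * ((1 / 2) * (Real.sqrt (∫ x, q x) * Real.sqrt (∫ x, ‖L x‖ ^ 2)) +
          Real.sqrt (2 / 3) * (Real.sqrt (∫ x, q x) * Real.sqrt (∫ x, D x))) :=
        mul_le_mul_of_nonneg_left (by nlinarith [cs1, cs2, mul_le_mul_of_nonneg_left cs2 h23]) hM0
    _ = M * ((1 / 2) * Real.sqrt (∫ x, ‖L x‖ ^ 2) * Real.sqrt (∫ x, q x) +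
          Real.sqrt (2 / 3) * Real.sqrt (∫ x, q x) * Real.sqrt (∫ x, D x)) := by ring

/-! ## The interpolation inequality -/

/-- **The sharp strain-cube interpolation.** For a smooth divergence-free field `v` on `ℝ³` with
`|v| ≤ M`, `‖Dv‖ ≤ B` and `D¹v, D²v ∈ L²`, and its strain `sᵢⱼ = ½(∂ⱼvᵢ + ∂ᵢvⱼ)`:
`∫ q√q ≤ M (½ √(∫‖Δv‖²) √(∫q) + √(2/3) √(∫q) √(∫ Σₗᵢⱼ(∂ₗsᵢⱼ)²))`, `q = Σᵢⱼ sᵢⱼ²` — the operator-norm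
gain `|S|_op ≤ √(2/3)|S|_F` on the `S∇N` term. [folklore] -/
theorem integral_strainCube_le_sharp (hv : ContDiff ℝ ∞ v) (hdiv : VectorCalculus.IsDivFree v)
    {M B : ℝ} (hM : ∀ x, ‖v x‖ ≤ M) (hB : ∀ x, ‖fderiv ℝ v x‖ ≤ B)
    (h1 : ∫⁻ x, ‖iteratedFDeriv ℝ 1 v x‖ₑ ^ 2 < ⊤) (h2 : ∫⁻ x, ‖iteratedFDeriv ℝ 2 v x‖ₑ ^ 2 < ⊤)
    (hs : ∀ i j y, s i j y = (pderiv j (fun z => v z i) y + pderiv i (fun z => v z j) y) / 2) :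
    ∫ x, (∑ i, ∑ j, s i j x ^ 2) * Real.sqrt (∑ i, ∑ j, s i j x ^ 2) ≤
      M * ((1 / 2) * Real.sqrt (∫ x, ‖(Δ v) x‖ ^ 2) * Real.sqrt (∫ x, ∑ i, ∑ j, s i j x ^ 2) +
        Real.sqrt (2 / 3) * Real.sqrt (∫ x, ∑ i, ∑ j, s i j x ^ 2) *
          Real.sqrt (∫ x, ∑ l, ∑ i, ∑ j, pderiv l (s i j) x ^ 2)) := by
  set q : EuclideanSpace ℝ (Fin 3) → ℝ := fun x => ∑ i, ∑ j, s i j x ^ 2 with hq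
  set R : ℝ := M * ((1 / 2) * Real.sqrt (∫ x, ‖(Δ v) x‖ ^ 2) * Real.sqrt (∫ x, q x) +
        Real.sqrt (2 / 3) * Real.sqrt (∫ x, q x) *
          Real.sqrt (∫ x, ∑ l, ∑ i, ∑ j, pderiv l (s i j) x ^ 2)) with hR
  have hsC := contDiff_sym hv hs
  have hq0 : ∀ x, 0 ≤ q x := fun x => sumSq_nonneg (s := s) x
  have cq : Continuous q := continuous_finsetSum _ fun i _ => continuous_finsetSum _ fun j _ =>
    ((hsC i j).continuous).pow 2
  have hB' : ∀ x, ‖iteratedFDeriv ℝ 1 v x‖ ≤ B := fun x => by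
    rw [← norm_fderiv_eq_norm_iteratedFDeriv_one]; exact hB x
  have iq : Integrable q := by
    refine integrable_of_le_iteratedFDeriv_mul hv h1 h1 cq 9 fun x => ?_
    rw [abs_of_nonneg (hq0 x)]
    nlinarith [sumSq_sym_le hv hs x]
  have iq32 : Integrable fun x => q x * Real.sqrt (q x) := by
    refine integrable_of_le_iteratedFDeriv_mul hv h1 h1 (cq.mul (Real.continuous_sqrt.comp cq)) (27 * B)
      fun x => ?_
    rw [abs_mul, abs_of_nonneg (hq0 x), abs_of_nonneg (Real.sqrt_nonneg _)]
    have T0 : 0 ≤ ‖iteratedFDeriv ℝ 1 v x‖ := norm_nonneg _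
    calc q x * Real.sqrt (q x) ≤ (9 * ‖iteratedFDeriv ℝ 1 v x‖ ^ 2) * (3 * ‖iteratedFDeriv ℝ 1 v x‖) :=
          mul_le_mul (sumSq_sym_le hv hs x) (sqrt_sumSq_sym_le hv hs x) (Real.sqrt_nonneg _) (by positivity)
      _ = (27 * ‖iteratedFDeriv ℝ 1 v x‖ * ‖iteratedFDeriv ℝ 1 v x‖) * ‖iteratedFDeriv ℝ 1 v x‖ := by ring
      _ ≤ (27 * ‖iteratedFDeriv ℝ 1 v x‖ * ‖iteratedFDeriv ℝ 1 v x‖) * B :=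
          mul_le_mul_of_nonneg_left (hB' x) (by positivity)
      _ = 27 * B * ‖iteratedFDeriv ℝ 1 v x‖ * ‖iteratedFDeriv ℝ 1 v x‖ := by ring
  -- the bound for every `ε > 0`
  have key : ∀ ε : ℝ, 0 < ε → ∫ x, q x * Real.sqrt (q x) ≤ R + ε * ∫ x, q x := by
    intro ε hε
    set N : EuclideanSpace ℝ (Fin 3) → ℝ := fun x => Real.sqrt (q x + ε ^ 2) - ε with hN
    have hNC : ContDiff ℝ ∞ N := contDiff_regMod hsC hε
    have hN0 : ∀ x, 0 ≤ N x := fun x => regMod_nonneg (s := s) hε x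
    have hNq : ∀ x, N x ≤ Real.sqrt (q x) := fun x => regMod_le_sqrt (s := s) hε x
    have hNle : ∀ x, N x ≤ 3 * ‖iteratedFDeriv ℝ 1 v x‖ := fun x =>
      (hNq x).trans (sqrt_sumSq_sym_le hv hs x)
    have hdND : ∀ x, ∑ l, pderiv l N x ^ 2 ≤ ∑ l, ∑ i, ∑ j, pderiv l (s i j) x ^ 2 := fun x =>
      Finset.sum_le_sum fun l _ => sq_pderiv_regMod_le hsC hε l x
    have hdN : ∀ l x, |pderiv l N x| ≤ 6 * ‖iteratedFDeriv ℝ 2 v x‖ := fun l x => by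
      refine (abs_pderiv_regMod_le hsC hε l x).trans ((Real.sqrt_le_sqrt ?_).trans (sqrt_gradSq_sym_le hv hs x))
      exact Finset.single_le_sum (f := fun l => ∑ i, ∑ j, pderiv l (s i j) x ^ 2)
        (fun l _ => sumSq_nonneg (s := fun i j y => pderiv l (s i j) y) x) (Finset.mem_univ l)
    have main := integral_sumSq_mul_weight_le_sharp hv hdiv hM hB h1 h2 hs hNC hN0 hNq hNle hdN hdND
    have cN : Continuous N := hNC.continuous
    have iqN : Integrable fun x => q x * N x := by
      refine iq32.mono' (cq.mul cN).aestronglyMeasurable (Eventually.of_forall fun x => ?_)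
      rw [Real.norm_eq_abs, abs_mul, abs_of_nonneg (hq0 x), abs_of_nonneg (hN0 x)]
      exact mul_le_mul_of_nonneg_left (hNq x) (hq0 x)
    have iSum : Integrable fun x => q x * N x + ε * q x := iqN.add (iq.const_mul ε)
    have hsum : ∫ x, (q x * N x + ε * q x) = (∫ x, q x * N x) + ε * ∫ x, q x := by
      rw [integral_add iqN (iq.const_mul ε), integral_const_mul]
    have step0 : ∫ x, q x * Real.sqrt (q x) ≤ (∫ x, q x * N x) + ε * ∫ x, q x := by
      rw [← hsum]
      refine integral_mono (f := fun x => q x * Real.sqrt (q x)) (g := fun x => q x * N x + ε * q x)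
        iq32 iSum fun x => ?_
      have h := sqrt_sub_regMod_le (s := s) (ε := ε) x
      have hqx := hq0 x
      change q x * Real.sqrt (q x) ≤ q x * N x + ε * q x
      nlinarith
    have main' : ∫ x, q x * N x ≤ R := main
    linarith [main']
  -- let `ε → 0`
  have hQ : 0 ≤ ∫ x, q x := integral_nonneg hq0
  refine le_of_forall_pos_le_add fun δ hδ => ?_
  have h := key (δ / ((∫ x, q x) + 1)) (by positivity)
  have : δ / ((∫ x, q x) + 1) * ∫ x, q x ≤ δ := by
    rw [div_mul_eq_mul_div, div_le_iff₀ (by positivity)]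
    nlinarith
  linarith

end Summit.NavierStokesRegularity.NavierStokesRegularity.Theorems.DepletionLadder.StrainCube

end
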